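import Summits.QuantumFields.YangMills.Theorems.CovariantDischargeCombSweepLinCobd
import HarnessLib

/-!
# Line «sandwich_discharge» on crux `HistoryTailL` (stmt-QuantumFields-19936), stub `stub_sandwichSweepGapCapped` — GLUE-B1′ v2 (LOCAL):
# THE COMB SWEEP'S ACTION LOWER BOUND IN THE `linCobd` CURRENCY WITH PER-PLAQUETTE THIRD-ORDER ROWS

Cell `ym3-torus` (YM ladder rung R3 = continuum SU(2) Yang–Mills on the three-torus — a RUNG, NOT the Clay problem: not d = 4, not
infinite volume, not a mass gap), width seat `ym-ust-19936-w5` gen 14, helper letters `--supports stmt-QuantumFields-19936`.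

WHY (px8 g7 located point 13:12:18Z on ✓`CovariantDischargeCombSweepLinCobd.comb_pairing_sub_le_wilsonAction4_sub_sweepInv`).  That theorem
takes ONE uniform `t` with `|c_b| ≤ t`, so its rows `r(t)·Σ_q dist1 V(∂q)` and `½Σ_q (|s_q| + D_q + r(t))²` run over EVERY plaquette of the
torus and grow with the volume — unaffordable for a bound that must be uniform in the fine level `K`.  The letter underneath
(✓`CovariantDischargeSweepSharpQuadraticCost.lin_sub_sharp_le_wilsonAction4_sub_mulField`) takes a PER-PLAQUETTE `t : Plaq → ℝ`; this file
re-derives §5 of ✓`CovariantDischargeCombSweepLinCobd` with `r(t_q) = 6t_q²+4t_q³+t_q⁴` INSIDE both sums, and — for the sweep pair — with the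
canonical majorant `t_q := |c(b₁)|+|c(b₂)|+|c(b₃)|+|c(b₄)|`, which VANISHES at every plaquette not meeting the swept set `S` (so do `s_q`, `D_q`):
every row localises to the plaquettes meeting `S`.
* ★★★ `comb_pairing_sub_le_wilsonAction4_sub_mulField_local` — generic framed factors `E_b = expPoint(c_b • Ad_{(axialT V c b.src)⁻¹} n̂₀)`,
  `|c_b| ≤ 1`, per-plaquette `t_q ≥ |c(bᵢ q)|`:
  `Σ_q (−s_q·F_q − D_q·dist1 V(∂q)) − Σ_q r(t_q)·dist1 V(∂q) − ½Σ_q (|s_q| + D_q + r(t_q))² ≤ A(V) − A(E·V)`;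
* ★★★ `comb_pairing_sub_le_wilsonAction4_sub_sweepInv_local` — the same for `Ψ′` of ✓`exists_sweep_pair_comb`, with `s`, `D`, `t` passed
  together with their defining equations from `cb` and `S`; ★★ `…_sweepInv_on` — the three sums restricted to any `T ⊇ {plaquettes meeting S}`.
HONEST SCOPE: deterministic per-configuration algebra under `PlaqSmall θ V`; nothing here chooses the profile, bounds the signal, or does the knit
arithmetic; nothing of `stub_sandwichSweepGapCapped`, `HistoryTailL` or any summit statement is proved or claimed.
[cite: Balaban1985Averaging, (8)-(10) p.19, (19)-(20) p.21, p.24; Balaban1987RG1, (0.2) p.252; Balaban1989LargeFieldI, (1.77) p.194]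
-/

noncomputable section

open scoped BigOperators RealInnerProductSpace Quaternion Matrix.Norms.L2Operator
open Literature.MathematicalPhysics.QuantumLattice (su2Quat quatMatrix)
open Literature.MathematicalPhysics.QuantumFieldTheory.Balaban1983to89
open Literature.MathematicalPhysics.QuantumFieldTheory.Balaban1983to89.T4CubeChartGnomonic (SU2)
open Literature.MathematicalPhysics.QuantumFieldTheory.Balaban1983to89.T4HaarSU2ExpChart (imQuat expPoint)
open Literature.MathematicalPhysics.QuantumFieldTheory.Balaban1983to89.T4ExpWindowSmallField (imVec)
open Literature.MathematicalPhysics.QuantumFieldTheory.Balaban1983to89.T4WilsonLinkAffine (bond₁ bond₂ bond₃ bond₄)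
open Literature.MathematicalPhysics.QuantumFieldTheory.Balaban1983to89.B15Prop1ChartSU2 (adSU2)
open Literature.MathematicalPhysics.QuantumFieldTheory.Balaban1983to89.B10Eq27TorusAxialLog (transl axialT)
open Literature.MathematicalPhysics.QuantumFieldTheory.Balaban1983to89.UnitaryModel (nReTr)
open Literature.MathematicalPhysics.QuantumFieldTheory.Balaban1983to89.T4TiltOscillation (nReTr_sub)
open Summit.QuantumFields.YangMills.Theorems.ApproxLift (mulField linCobd)
open Summit.QuantumFields.YangMills.Theorems.CovariantDischargeSweepActionVariation (abs_nReTr_mul_sub_one_le)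
open Summit.QuantumFields.YangMills.Theorems.CovariantDischargeSweepSharpQuadraticCost (lin_sub_sharp_le_wilsonAction4_sub_mulField)
open Summit.QuantumFields.YangMills.Theorems.CovariantDischargeFramedPlaquetteTransport (expPoint_smul_adSU2 dist1_expPoint_smul_le)
open Summit.QuantumFields.YangMills.Theorems.CovariantDischargeFramedSweepLinCobd (norm_conj_eq)
open Summit.QuantumFields.YangMills.Theorems.CovariantDischargeFramedFactorFirstOrder (norm_quatMatrix_imQuat_smul)
open Summit.QuantumFields.YangMills.Theorems.CovariantDischargeCombSweepLinCobd (sweepInv_eq_mulField combFactor_eq_expPoint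
  nReTr_combPattern_mul_sub_one norm_linCobd_comb_sub_le)

namespace Summit.QuantumFields.YangMills.Theorems.CovariantDischargeCombSweepLinCobdLocal

variable {P : Params} {j : ℕ}

/-- ★★★ **THE ACTION LOWER BOUND OF A COMB-FRAMED LEFT PRODUCT, B1′ CURRENCY, PER-PLAQUETTE THIRD-ORDER ROWS.**  With
`E_b = expPoint(c_b • Ad_{(axialT V c b.src)⁻¹} n̂₀)`, `‖n̂₀‖ = 1`, `|c_b| ≤ 1`, every `b` with `c_b ≠ 0` sourced in the ball `{c + z : ‖z‖_∞ ≤ r}`,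
`2(r+2) ≤` period, `PlaqSmall θ V`, a per-plaquette majorant `t_q ≥ |c(bᵢ q)|` (`i = 1…4`), and the abbreviations
`s_q = c(b₁)+c(b₂)−c(b₃)−c(b₄)`, `D_q = 2Σᵢc(bᵢ)² + 2(|c(b₂)|η + |c(b₃)|·3η + |c(b₄)|θ)` (passed as functions with their defining equations),
`r(t) = 6t²+4t³+t⁴`, `W̃ := V^{axialT V c}`:
`Σ_q (−s_q·⟨n̂₀, imVec su2Quat W̃(∂q)⟩ − D_q·dist1 V(∂q)) − Σ_q r(t_q)·dist1 V(∂q) − ½·Σ_q (|s_q| + D_q + r(t_q))² ≤ A(V) − A(E·V)`.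
[cite: Balaban1985Averaging, (10) p.19, (19)-(20) p.21, p.24; Balaban1987RG1, (0.2) p.252] -/
theorem comb_pairing_sub_le_wilsonAction4_sub_mulField_local {θ : ℝ} (hθ : 0 ≤ θ) {V : GaugeField P j SU2} (hV : PlaqSmall θ V)
    (c : Site P j) {r : ℕ} (hr : 2 * (r + 2) ≤ P.sitesPerDir j) {n : EuclideanSpace ℝ (Fin 3)} (hn : ‖n‖ = 1)
    (E : GaugeField P j SU2) (cf : PBond P j → ℝ) (hE : ∀ b, E b = expPoint (cf b • adSU2 (axialT V c b.src)⁻¹ n))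
    (hcf : ∀ b, cf b ≠ 0 → ∃ z : Fin P.d → ℤ, (∀ ν, (z ν).natAbs ≤ r) ∧ b.src = transl c z) (h1 : ∀ b, |cf b| ≤ 1)
    (t : Plaq P j → ℝ) (ht₁ : ∀ q, |cf (bond₁ q)| ≤ t q) (ht₂ : ∀ q, |cf (bond₂ q)| ≤ t q) (ht₃ : ∀ q, |cf (bond₃ q)| ≤ t q)
    (ht₄ : ∀ q, |cf (bond₄ q)| ≤ t q) (s D : Plaq P j → ℝ)
    (hs : ∀ q, s q = cf (bond₁ q) + cf (bond₂ q) - cf (bond₃ q) - cf (bond₄ q))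
    (hD : ∀ q, D q = 2 * (cf (bond₁ q) ^ 2 + cf (bond₂ q) ^ 2 + cf (bond₃ q) ^ 2 + cf (bond₄ q) ^ 2) +
        2 * (|cf (bond₂ q)| * ((((2 * P.d * (r + 1) + 2 : ℕ) : ℝ) ^ 2 / 4) * θ) +
          |cf (bond₃ q)| * (3 * ((((2 * P.d * (r + 1) + 2 : ℕ) : ℝ) ^ 2 / 4) * θ)) + |cf (bond₄ q)| * θ)) :
    (∑ q : Plaq P j,
        (-s q * ⟪n, imVec (su2Quat (GaugeField.plaqHol (GaugeField.gaugeAct (axialT V c) V) q))⟫ -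
          D q * dist1 (GaugeField.plaqHol V q))) -
      (∑ q : Plaq P j, (6 * t q ^ 2 + 4 * t q ^ 3 + t q ^ 4) * dist1 (GaugeField.plaqHol V q)) -
      1 / 2 * ∑ q : Plaq P j, (|s q| + D q + (6 * t q ^ 2 + 4 * t q ^ 3 + t q ^ 4)) ^ 2 ≤
      wilsonAction4 V - wilsonAction4 (mulField E V) := by
  -- the four `dist1 (E ·) ≤ t_q` of the sharp main letter
  have hd : ∀ b, dist1 (E b) ≤ |cf b| := fun b => by
    rw [hE b, expPoint_smul_adSU2, GaugeGroup.dist1_conj]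
    exact dist1_expPoint_smul_le hn _
  have hB := lin_sub_sharp_le_wilsonAction4_sub_mulField E V (t := t) (fun q => (hd _).trans (ht₁ q))
    (fun q => (hd _).trans (ht₂ q)) (fun q => (hd _).trans (ht₃ q)) (fun q => (hd _).trans (ht₄ q))
  refine le_trans ?_ hB
  -- per plaquette: the pairing from below and the norm of `linCobd` from above
  have key : ∀ q : Plaq P j,
      -s q * ⟪n, imVec (su2Quat (GaugeField.plaqHol (GaugeField.gaugeAct (axialT V c) V) q))⟫ -
          D q * dist1 (GaugeField.plaqHol V q) ≤
        nReTr (linCobd E V q * (((GaugeField.plaqHol V q : SU2) : Matrix (Fin 2) (Fin 2) ℂ) - 1)) ∧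
      (‖linCobd E V q‖ + (6 * t q ^ 2 + 4 * t q ^ 3 + t q ^ 4)) ^ 2 ≤
        (|s q| + D q + (6 * t q ^ 2 + 4 * t q ^ 3 + t q ^ 4)) ^ 2 := by
    intro q
    have ht0 : 0 ≤ t q := (abs_nonneg _).trans (ht₁ q)
    have hrt0 : 0 ≤ 6 * t q ^ 2 + 4 * t q ^ 3 + t q ^ 4 := by positivity
    have hdef := norm_linCobd_comb_sub_le hθ hV c hr hn E cf hE hcf h1 q
    rw [← hs q, ← hD q] at hdef
    set X : Matrix (Fin 2) (Fin 2) ℂ := (((axialT V c q.src)⁻¹ : SU2) : Matrix (Fin 2) (Fin 2) ℂ) *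
        quatMatrix (imQuat (s q • n)) * ((axialT V c q.src : SU2) : Matrix (Fin 2) (Fin 2) ℂ) with hX
    have hXn : ‖X‖ = |s q| := by
      have h := norm_conj_eq (axialT V c q.src)⁻¹ (quatMatrix (imQuat (s q • n)))
      rw [inv_inv] at h
      rw [hX, h, norm_quatMatrix_imQuat_smul hn]
    have hpair : nReTr (X * (((GaugeField.plaqHol V q : SU2) : Matrix (Fin 2) (Fin 2) ℂ) - 1)) =
        -s q * ⟪n, imVec (su2Quat (GaugeField.plaqHol (GaugeField.gaugeAct (axialT V c) V) q))⟫ := by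
      rw [hX, nReTr_combPattern_mul_sub_one, real_inner_smul_left, neg_mul]
    have hsplit : nReTr (linCobd E V q * (((GaugeField.plaqHol V q : SU2) : Matrix (Fin 2) (Fin 2) ℂ) - 1)) =
        nReTr (X * (((GaugeField.plaqHol V q : SU2) : Matrix (Fin 2) (Fin 2) ℂ) - 1)) +
          nReTr ((linCobd E V q - X) * (((GaugeField.plaqHol V q : SU2) : Matrix (Fin 2) (Fin 2) ℂ) - 1)) := by
      rw [sub_mul, nReTr_sub]
      ring
    have hrem := abs_nReTr_mul_sub_one_le (linCobd E V q - X) (GaugeField.plaqHol V q)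
    have hd0 := GaugeGroup.dist1_nonneg (GaugeField.plaqHol V q)
    have hrem' : -(D q * dist1 (GaugeField.plaqHol V q)) ≤
        nReTr ((linCobd E V q - X) * (((GaugeField.plaqHol V q : SU2) : Matrix (Fin 2) (Fin 2) ℂ) - 1)) := by
      have := (abs_le.mp hrem).1
      nlinarith [mul_le_mul_of_nonneg_right hdef hd0]
    refine ⟨?_, ?_⟩
    · rw [hsplit, hpair]
      linarith
    · have hle : ‖linCobd E V q‖ ≤ |s q| + D q := by
        have h := norm_le_norm_add_norm_sub' (linCobd E V q) X
        rw [hXn] at h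
        linarith
      have h0 : 0 ≤ ‖linCobd E V q‖ + (6 * t q ^ 2 + 4 * t q ^ 3 + t q ^ 4) := add_nonneg (norm_nonneg _) hrt0
      exact pow_le_pow_left₀ h0 (by linarith) 2
  have S₁ := Finset.sum_le_sum fun q (_ : q ∈ (Finset.univ : Finset (Plaq P j))) => (key q).1
  have S₃ := Finset.sum_le_sum fun q (_ : q ∈ (Finset.univ : Finset (Plaq P j))) => (key q).2
  linarith

/-- ★★★ **THE SAME FOR THE SWEEP PAIR OF ✓`exists_sweep_pair_comb`, EVERY ROW LOCALISED TO THE PLAQUETTES MEETING `S`**: with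
`Ψ′U = (b ↦ n_b(U)⁻¹·U_b on S)`, `n_b(U) = expPoint(cb_b • Ad_{(axialT U c b.src)⁻¹} n̂₀)`, sources of `S` in the ball, `|cb_b| ≤ 1` on `S`,
the signed amplitude `c_b = −cb_b` on `S`, `0` off `S`, and `s_q`, `D_q`, `t_q := |c(b₁)|+|c(b₂)|+|c(b₃)|+|c(b₄)|` passed with their defining
equations — all three vanish at every plaquette none of whose four bonds lies in `S`:
`Σ_q (−s_q·⟨n̂₀, imVec su2Quat W̃(∂q)⟩ − D_q·dist1 V(∂q)) − Σ_q r(t_q)·dist1 V(∂q) − ½·Σ_q (|s_q| + D_q + r(t_q))² ≤ A(V) − A(Ψ′V)`.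
[cite: Balaban1985Averaging, (10) p.19, (19)-(20) p.21, p.24; Balaban1987RG1, (0.2) p.252] -/
theorem comb_pairing_sub_le_wilsonAction4_sub_sweepInv_local [DecidableEq (PBond P j)] {θ : ℝ} (hθ : 0 ≤ θ)
    {V : GaugeField P j SU2} (hV : PlaqSmall θ V) (c : Site P j) {r : ℕ} (hr : 2 * (r + 2) ≤ P.sitesPerDir j)
    {n : EuclideanSpace ℝ (Fin 3)} (hn : ‖n‖ = 1)
    (S : Finset (PBond P j)) (hS : ∀ b ∈ S, ∃ z : Fin P.d → ℤ, (∀ ν, (z ν).natAbs ≤ r) ∧ b.src = transl c z)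
    (cb : PBond P j → ℝ) (nf : PBond P j → GaugeField P j SU2 → SU2)
    (hnf : ∀ b U, nf b U = expPoint (cb b • adSU2 (axialT U c b.src)⁻¹ n))
    (Ψ' : GaugeField P j SU2 → GaugeField P j SU2) (hΨ' : ∀ U b, Ψ' U b = if b ∈ S then (nf b U)⁻¹ * U b else U b)
    (h1 : ∀ b ∈ S, |cb b| ≤ 1) (s D t : Plaq P j → ℝ)
    (hs : ∀ q, s q = (if bond₁ q ∈ S then -cb (bond₁ q) else 0) + (if bond₂ q ∈ S then -cb (bond₂ q) else 0) -
        (if bond₃ q ∈ S then -cb (bond₃ q) else 0) - (if bond₄ q ∈ S then -cb (bond₄ q) else 0))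
    (hD : ∀ q, D q = 2 * ((if bond₁ q ∈ S then -cb (bond₁ q) else 0) ^ 2 + (if bond₂ q ∈ S then -cb (bond₂ q) else 0) ^ 2 +
          (if bond₃ q ∈ S then -cb (bond₃ q) else 0) ^ 2 + (if bond₄ q ∈ S then -cb (bond₄ q) else 0) ^ 2) +
        2 * (|(if bond₂ q ∈ S then -cb (bond₂ q) else 0)| * ((((2 * P.d * (r + 1) + 2 : ℕ) : ℝ) ^ 2 / 4) * θ) +
          |(if bond₃ q ∈ S then -cb (bond₃ q) else 0)| * (3 * ((((2 * P.d * (r + 1) + 2 : ℕ) : ℝ) ^ 2 / 4) * θ)) +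
          |(if bond₄ q ∈ S then -cb (bond₄ q) else 0)| * θ))
    (hT : ∀ q, t q = |(if bond₁ q ∈ S then -cb (bond₁ q) else 0)| + |(if bond₂ q ∈ S then -cb (bond₂ q) else 0)| +
        |(if bond₃ q ∈ S then -cb (bond₃ q) else 0)| + |(if bond₄ q ∈ S then -cb (bond₄ q) else 0)|) :
    (∑ q : Plaq P j,
        (-s q * ⟪n, imVec (su2Quat (GaugeField.plaqHol (GaugeField.gaugeAct (axialT V c) V) q))⟫ -
          D q * dist1 (GaugeField.plaqHol V q))) -
      (∑ q : Plaq P j, (6 * t q ^ 2 + 4 * t q ^ 3 + t q ^ 4) * dist1 (GaugeField.plaqHol V q)) -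
      1 / 2 * ∑ q : Plaq P j, (|s q| + D q + (6 * t q ^ 2 + 4 * t q ^ 3 + t q ^ 4)) ^ 2 ≤
      wilsonAction4 V - wilsonAction4 (Ψ' V) := by
  rw [sweepInv_eq_mulField S nf Ψ' hΨ' V]
  have hE : ∀ b, (fun b => if b ∈ S then (nf b V)⁻¹ else (1 : SU2)) b =
      expPoint ((fun b => if b ∈ S then -cb b else 0) b • adSU2 (axialT V c b.src)⁻¹ n) := fun b =>
    combFactor_eq_expPoint c n cb S nf hnf V b
  have hcf : ∀ b, (fun b => if b ∈ S then -cb b else 0) b ≠ 0 →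
      ∃ z : Fin P.d → ℤ, (∀ ν, (z ν).natAbs ≤ r) ∧ b.src = transl c z := by
    intro b hb
    by_cases h : b ∈ S
    · exact hS b h
    · exact absurd (by simp [h]) hb
  have h1' : ∀ b, |(fun b => if b ∈ S then -cb b else 0) b| ≤ 1 := by
    intro b
    by_cases h : b ∈ S
    · simp only [h, if_true, abs_neg]; exact h1 b h
    · simp only [h, if_false, abs_zero]; exact zero_le_one
  have a₁ := fun q : Plaq P j => abs_nonneg (if bond₁ q ∈ S then -cb (bond₁ q) else 0)
  have a₂ := fun q : Plaq P j => abs_nonneg (if bond₂ q ∈ S then -cb (bond₂ q) else 0)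
  have a₃ := fun q : Plaq P j => abs_nonneg (if bond₃ q ∈ S then -cb (bond₃ q) else 0)
  have a₄ := fun q : Plaq P j => abs_nonneg (if bond₄ q ∈ S then -cb (bond₄ q) else 0)
  exact comb_pairing_sub_le_wilsonAction4_sub_mulField_local hθ hV c hr hn _ _ hE hcf h1' t
    (fun q => by rw [hT q]; linarith [a₂ q, a₃ q, a₄ q]) (fun q => by rw [hT q]; linarith [a₁ q, a₃ q, a₄ q])
    (fun q => by rw [hT q]; linarith [a₁ q, a₂ q, a₄ q]) (fun q => by rw [hT q]; linarith [a₁ q, a₂ q, a₃ q]) s D hs hD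

/-- ★★ **… RESTRICTED TO ANY SET OF PLAQUETTES CARRYING `S`**: if every plaquette outside `T` has none of its four bonds in `S`, the three
sums of ✓`comb_pairing_sub_le_wilsonAction4_sub_sweepInv_local` may be taken over `T` only (their summands vanish off `T`); the door takes
`T :=` the plaquettes meeting `S` (`#T ≤ 2(d−1)·#S`). [cite: Balaban1985Averaging, (10) p.19, (19)-(20) p.21, p.24] -/
theorem comb_pairing_sub_le_wilsonAction4_sub_sweepInv_on [DecidableEq (PBond P j)] {θ : ℝ} (hθ : 0 ≤ θ)
    {V : GaugeField P j SU2} (hV : PlaqSmall θ V) (c : Site P j) {r : ℕ} (hr : 2 * (r + 2) ≤ P.sitesPerDir j)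
    {n : EuclideanSpace ℝ (Fin 3)} (hn : ‖n‖ = 1)
    (S : Finset (PBond P j)) (hS : ∀ b ∈ S, ∃ z : Fin P.d → ℤ, (∀ ν, (z ν).natAbs ≤ r) ∧ b.src = transl c z)
    (cb : PBond P j → ℝ) (nf : PBond P j → GaugeField P j SU2 → SU2)
    (hnf : ∀ b U, nf b U = expPoint (cb b • adSU2 (axialT U c b.src)⁻¹ n))
    (Ψ' : GaugeField P j SU2 → GaugeField P j SU2) (hΨ' : ∀ U b, Ψ' U b = if b ∈ S then (nf b U)⁻¹ * U b else U b)
    (h1 : ∀ b ∈ S, |cb b| ≤ 1) (s D t : Plaq P j → ℝ)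
    (hs : ∀ q, s q = (if bond₁ q ∈ S then -cb (bond₁ q) else 0) + (if bond₂ q ∈ S then -cb (bond₂ q) else 0) -
        (if bond₃ q ∈ S then -cb (bond₃ q) else 0) - (if bond₄ q ∈ S then -cb (bond₄ q) else 0))
    (hD : ∀ q, D q = 2 * ((if bond₁ q ∈ S then -cb (bond₁ q) else 0) ^ 2 + (if bond₂ q ∈ S then -cb (bond₂ q) else 0) ^ 2 +
          (if bond₃ q ∈ S then -cb (bond₃ q) else 0) ^ 2 + (if bond₄ q ∈ S then -cb (bond₄ q) else 0) ^ 2) +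
        2 * (|(if bond₂ q ∈ S then -cb (bond₂ q) else 0)| * ((((2 * P.d * (r + 1) + 2 : ℕ) : ℝ) ^ 2 / 4) * θ) +
          |(if bond₃ q ∈ S then -cb (bond₃ q) else 0)| * (3 * ((((2 * P.d * (r + 1) + 2 : ℕ) : ℝ) ^ 2 / 4) * θ)) +
          |(if bond₄ q ∈ S then -cb (bond₄ q) else 0)| * θ))
    (hT : ∀ q, t q = |(if bond₁ q ∈ S then -cb (bond₁ q) else 0)| + |(if bond₂ q ∈ S then -cb (bond₂ q) else 0)| +
        |(if bond₃ q ∈ S then -cb (bond₃ q) else 0)| + |(if bond₄ q ∈ S then -cb (bond₄ q) else 0)|)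
    (T : Finset (Plaq P j)) (hT' : ∀ q, q ∉ T → bond₁ q ∉ S ∧ bond₂ q ∉ S ∧ bond₃ q ∉ S ∧ bond₄ q ∉ S) :
    (∑ q ∈ T,
        (-s q * ⟪n, imVec (su2Quat (GaugeField.plaqHol (GaugeField.gaugeAct (axialT V c) V) q))⟫ -
          D q * dist1 (GaugeField.plaqHol V q))) -
      (∑ q ∈ T, (6 * t q ^ 2 + 4 * t q ^ 3 + t q ^ 4) * dist1 (GaugeField.plaqHol V q)) -
      1 / 2 * ∑ q ∈ T, (|s q| + D q + (6 * t q ^ 2 + 4 * t q ^ 3 + t q ^ 4)) ^ 2 ≤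
      wilsonAction4 V - wilsonAction4 (Ψ' V) := by
  have h := comb_pairing_sub_le_wilsonAction4_sub_sweepInv_local hθ hV c hr hn S hS cb nf hnf Ψ' hΨ' h1 s D t hs hD hT
  -- off `T` all three summands vanish
  have hz : ∀ q, q ∉ T → s q = 0 ∧ D q = 0 ∧ t q = 0 := by
    intro q hq
    obtain ⟨h₁, h₂, h₃, h₄⟩ := hT' q hq
    refine ⟨?_, ?_, ?_⟩
    · rw [hs q]; simp [h₁, h₂, h₃, h₄]
    · rw [hD q]; simp [h₁, h₂, h₃, h₄]
    · rw [hT q]; simp [h₁, h₂, h₃, h₄]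
  have e₁ : (∑ q ∈ T, (-s q * ⟪n, imVec (su2Quat (GaugeField.plaqHol (GaugeField.gaugeAct (axialT V c) V) q))⟫ -
      D q * dist1 (GaugeField.plaqHol V q))) =
      ∑ q : Plaq P j, (-s q * ⟪n, imVec (su2Quat (GaugeField.plaqHol (GaugeField.gaugeAct (axialT V c) V) q))⟫ -
        D q * dist1 (GaugeField.plaqHol V q)) :=
    Finset.sum_subset (Finset.subset_univ T) fun q _ hq => by
      obtain ⟨hs0, hD0, -⟩ := hz q hq
      rw [hs0, hD0]; ring
  have e₂ : (∑ q ∈ T, (6 * t q ^ 2 + 4 * t q ^ 3 + t q ^ 4) * dist1 (GaugeField.plaqHol V q)) =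
      ∑ q : Plaq P j, (6 * t q ^ 2 + 4 * t q ^ 3 + t q ^ 4) * dist1 (GaugeField.plaqHol V q) :=
    Finset.sum_subset (Finset.subset_univ T) fun q _ hq => by
      obtain ⟨-, -, ht0⟩ := hz q hq
      rw [ht0]; ring
  have e₃ : (∑ q ∈ T, (|s q| + D q + (6 * t q ^ 2 + 4 * t q ^ 3 + t q ^ 4)) ^ 2) =
      ∑ q : Plaq P j, (|s q| + D q + (6 * t q ^ 2 + 4 * t q ^ 3 + t q ^ 4)) ^ 2 :=
    Finset.sum_subset (Finset.subset_univ T) fun q _ hq => by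
      obtain ⟨hs0, hD0, ht0⟩ := hz q hq
      rw [hs0, hD0, ht0, abs_zero]; ring
  rw [e₁, e₂, e₃]
  exact h

end Summit.QuantumFields.YangMills.Theorems.CovariantDischargeCombSweepLinCobdLocal

end
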